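import Literature.MathematicalPhysics.QuantumFieldTheory.Balaban1983to89.B15Prop1CriticalViaSlice
import Literature.MathematicalPhysics.QuantumFieldTheory.Balaban1983to89.B16Prop1IVFromProp4

/-!
# `Balaban1983to89.B15Prop1AnalyticExtClause` — [Balaban1989LargeFieldI] Prop. 1 p. 194, last clause: *«The orbit-valued function
# V_Λ(V_k↾_{Z∩Λᶜ}) has an analytic extension for Gᶜ-valued configurations 𝕍_k = V′_kV_k = exp iB′V_k satisfying the same regularity
# condition as V_k, with B′ ∈ 𝔤ᶜ and small, e.g., |B′| < ε»* — THE CLAUSE TYPED AT THE CARRIER OF RECORD (`anExt`), and its junction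
# with r13's complex twin of the p. 359 proof (`B16Prop1IVFromProp4.prop1IV_complex`): [Balaban1989LargeFieldII] p. 359 *«The above
# equations, bounds and statements are valid for 𝔤ᶜ-valued fields, hence the existence of the analytic extension follows immediately»*

statement-level skeleton of published theorems with citation tags; proofs where landed; nothing here is a claim about
the Yang–Mills mass gap

Cell pub-ymgap, HUMAN RULING D-0062 (Track A full width), seat `pub-ymgap-dag-n12-c` (R134 acceleration seat (a), strategy s1 of DAG node
N12 = [B15]; generation g4, ninth product; dag-lead REBALANCE №68 «(x): the ANALYTIC-EXTENSION clause `An` of Prop. 1 typed against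
`B16Prop1IVFromProp4.prop1IV_of_ineq19_prop4`»).  PDFs held: `paper:balaban1989-cmp122-large-field-i` (p. 194 = PDF 20),
`paper:balaban1989-cmp122-large-field-ii` (p. 359 = PDF 5, text layer read this session: *«We fix such an extension, and we consider the
variational problem for the function V′↾_Λ → A(U_{k,Z}(V′V_k)) … The above equations, bounds and statements are valid for 𝔤ᶜ-valued fields,
hence the existence of the analytic extension follows immediately, and Proposition 1 [IV] is proved.»*).

STATE OF THE TREE.  The carrier of record `B15Prop1Carrier.lfVarOn ch I` CARRIES the clause as DATA: `InstOn.An : ℝ → GaugeField → Prop`,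
read verbatim into `B15.LFVar.AnalyticExt` (HONEST SCOPE (i) there: *«its only typed model is the complex twin
B16Prop1IVFromProp4.prop1IV_of_ineq19_prop4 (r13). A consumer who instantiates An by True weakens Proposition 1 visibly»*); the N12∕s1 chain
(endpoint `B15Prop1LocalLettersRecord.exists_domain_prop1Printed_lfVarOn_std_su2_box_regular`) takes `An` as a parameter with the letter `hAn`.
r13's complex model (`B16Prop1IVAnalytic`, `B16Prop1IVFromProp4.prop1IV_complex`): over `ℂ`, for fixed operators `H = H_{1,k}`, `H*`,
`Δ₁ = Δ₁(ζ₀)`, `(δ/δA)V` (r13's reading of (1.13): *«the solution of (1.13) is an ANALYTIC function of its right-hand side, hence of the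
current J = J_{k,Z} (through which the field V_k enters (1.13) linearly)»*), the (1.12)-critical configuration `B′(J)` is `ℂ`-analytic in `J`
and unique in the gauge ball.

WHAT THIS FILE DOES (Mathlib + the two imports; no `sorry`, no `… : Prop` fact beyond the ONE definition of the clause; no `instance`, no
`notation`; axioms standard).
§1 THE CLAUSE (definitions with bodies): `cplxVec` (complexification of a real `ℝ³`-valued bond field, bondwise `ofReal`), `cplxSlice` (the real
   coordinate space `GaugeSlice S T ℝ³` inside the complexified `GaugeSlice S T ℂ³`, norm-preserving and `ℂ`-spanning: `norm_cplxSlice`,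
   `cplxSlice_span` via `reSlice`∕`imSlice`), and ★ **`anExt S T f ext r`** — `anExt … ε V_k` := THERE IS a map `Φ` from the complexified bond fields
   to the complexified coordinates, `ℂ`-ANALYTIC on the ball `‖·‖ < ε`, whose value at every REAL small perturbation `p` (`‖p‖ < ε`) is
   `cplxSlice B` for every gauge-fixed coordinate `B`, `‖B‖ ≤ r`,
   of a critical configuration of the perturbed datum `exp(ip)·V_k` — the orbit-valued function `p ↦ V_Λ(exp(ip)V_k)`, read through its
   `G₀`-gauge-fixed coordinate (unique in the ball by the chain), IS the restriction of an analytic function of the complexified perturbation.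
§2 ★★ **`exists_analyticExt_of_complexModel`** (abstract real∕complex model; the junction with r13): given (a) real data `H`, `Δ₁`, `dV` and a
   real current `J p` depending on a real parameter `p`, (b) their COMPLEXIFICATIONS — a complex model `Hc`, `Hstc` (adjoint), `Δ₁c`, `W`
   satisfying r13's hypotheses of `prop1IV_complex` with `P₀ = id` ((1.9) over `ℂ`, `Prop4Hyp W C₄ a₃`, norms, room and smallness), real-linear
   embeddings `ιE : E → Ec` (norm-non-increasing, `ℂ`-spanning) and `emb : F → Fc` (totally real: `⟨emb u, emb v⟩_ℂ = ⟨u, v⟩_ℝ`) intertwining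
   them (`Hc ∘ ιE = emb ∘ H`, `Δ₁c ∘ emb = emb ∘ Δ₁`, `W ∘ emb = emb ∘ dV`), and (c) a complex current `Jc` ANALYTIC on the parameter ball
   `‖p̃‖ < ε`, small there (`c⁻¹·hst·‖Jc p̃‖ < r`), and equal to `emb (J p)` at real parameters `ιP p` — THEN there is `Φ : Pc → Ec`,
   `ℂ`-analytic on the ball, with `Φ (ιP p) = ιE B` for every real `‖p‖ < ε` (`‖ιP p‖ ≤ ‖p‖`) and every `B ∈ E`, `‖B‖ ≤ r`, solving the REAL
   criticality equation (1.12) `∀ δ, ⟨Hδ, J p⟩ + ⟨Hδ, Δ₁HB⟩ + ⟨Hδ, dV(HB)⟩ = 0`.  Proof: `Φ = B′(·) ∘ Jc` with r13's analytic `B′(J)`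
   (`prop1IV_complex`), and at real parameters `ιE B` solves the COMPLEX (1.12) (the three pairings are the real ones by the intertwinings and
   the totally-real `emb`; conjugate-linearity in `δ` and the `ℂ`-span of `ιE(E)` give all complex variations), so r13's uniqueness in the
   gauge ball identifies it with `B′(Jc(ιP p))`.
§3 ★★ **`anExt_of_complexModel`** — THE CLAUSE AT THE CARRIER OF RECORD from §2 and the chain's letters at the perturbed data: with the
   (c3)-shape letter `hc3p` (criticality of `exp(i·ιA B)·ext(exp(ip)V_k)` ⇔ the real (1.12) with the data `(H, Δ₁, dV, J p)` — the chain's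
   (c3)∕(m5) letters at the datum `exp(ip)V_k` under r13's reading that `H_{1,k}`, `Δ₁(ζ₀)`, `(δ/δA)V` are the reference-background operators
   and the datum enters through the current), `anExt S T f ext r ε V_k` holds (no free target space: `Ec := GaugeSlice S T ℂ³`, `ιE := cplxSlice`).

HONEST SCOPE.  (i) Definitions: `anExt` and its coordinate plumbing `cplxVec`, `cplxSlice`, `reSlice`, `imSlice` — the rest are theorems; the clause is typed through the GAUGE-FIXED COORDINATE of
the critical orbit (print: *«orbit-valued function»*; the coordinate is unique in the `r`-ball by `B15Prop1MinimumBall.critical_unique_of_chart_ball`).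
(ii) The complex data (`Hc`, `Δ₁c`, `W`, `Jc`, `Ec`, `Fc`, `ιE`, `emb`) and their letters are NODE 00's complexified pieces of record — displayed,
not constructed; `hc3p` carries r13's fixed-operator reading explicitly (if NODE 00's `H_{1,k}` varies with the datum, the junction needs the
parametric analytic implicit-function theorem instead of `prop1IV_complex` — not done here).  (iii) `SU(2)`, real `ℝ³` Lie algebra complexified
bondwise to `ℂ³`.  Count-neutral; NOT a discharge of N12; NOT summit progress; nothing continuum ∕ OS ∕ mass-gap ∕ Clay.
-/

noncomputable section

open Set Metric
open scoped InnerProductSpace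

namespace Literature.MathematicalPhysics.QuantumFieldTheory.Balaban1983to89.B15Prop1AnalyticExtClause

open B16Sect1Backgrounds B15Prop1Carrier B15DeterminingSets GaugeField B15Prop1ChartSU2 B15Prop1ChartCalculusSU2
open B15Prop1SliceCoordinates (GaugeSlice ιA freeBonds)
open T4CubeChartGnomonic (SU2)
open B11Prop6Scheme (Prop4Hyp)
open B16Prop1IVFromProp4 (prop1IV_complex)

/-! ## §1 The clause, typed -/

section Clause

variable {P : Params} {k : ℕ}

/-- **COMPLEXIFICATION OF A REAL BOND FIELD**: `cplxVec p (b) = (p(b) : ℂ³)` (coordinatewise `ofReal`) — the real directions `B′ ∈ 𝔤` inside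
the complexified perturbations `B′ ∈ 𝔤ᶜ` of Proposition 1's last clause. [cite: Balaban1989LargeFieldI, Prop. 1 p.194 («𝕍_k = V′_kV_k = exp iB′V_k
… with B′ ∈ 𝔤ᶜ and small»)] -/
def cplxVec (p : VecField P k E3) : VecField P k (EuclideanSpace ℂ (Fin 3)) :=
  fun b => WithLp.toLp 2 fun i => ((p b) i : ℂ)

/-- `‖cplxVec p (b)‖ = ‖p (b)‖` bondwise. [cite: Balaban1989LargeFieldI, Prop. 1 p.194] -/
theorem norm_cplxVec_apply (p : VecField P k E3) (b : PBond P k) : ‖cplxVec p b‖ = ‖p b‖ := by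
  rw [cplxVec, EuclideanSpace.norm_eq, EuclideanSpace.norm_eq]
  congr 1
  refine Finset.sum_congr rfl fun i _ => ?_
  simp

/-- `‖cplxVec p‖ = ‖p‖` (sup over bonds). [cite: Balaban1989LargeFieldI, Prop. 1 p.194] -/
theorem norm_cplxVec (p : VecField P k E3) : ‖cplxVec p‖ = ‖p‖ := by
  simp only [Pi.norm_def]
  congr 1
  refine Finset.sup_congr rfl fun b _ => ?_
  ext
  simp only [coe_nnnorm]
  exact norm_cplxVec_apply p b

variable [DecidableEq (PBond P k)]

/-- **COMPLEXIFICATION OF THE GAUGE-FIXED COORDINATES**: `cplxSlice B (b) = (B(b) : ℂ³)` — the real coordinate space `GaugeSlice S T ℝ³` inside the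
complexified one `GaugeSlice S T ℂ³` (print's `B′ ∈ 𝔤` inside `B′ ∈ 𝔤ᶜ` on the free bonds), a real-linear map. [cite: Balaban1989LargeFieldI,
Prop. 1 p.194] -/
def cplxSlice (S : Set (Site P k)) (T : Finset (PBond P k)) :
    GaugeSlice S T E3 →ₗ[ℝ] GaugeSlice S T (EuclideanSpace ℂ (Fin 3)) where
  toFun B := WithLp.toLp 2 fun i => WithLp.toLp 2 fun j => ((B i) j : ℂ)
  map_add' B B' := by
    ext i j
    simp
  map_smul' c B := by
    ext i j
    simp

/-- `cplxSlice` coordinatewise. [cite: Balaban1989LargeFieldI, Prop. 1 p.194] -/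
@[simp] theorem cplxSlice_apply (S : Set (Site P k)) (T : Finset (PBond P k)) (B : GaugeSlice S T E3) (i : ↥(freeBonds S T))
    (j : Fin 3) : cplxSlice S T B i j = ((B i) j : ℂ) := rfl

/-- `cplxSlice` is norm-preserving (`|x| = |(x : ℂ)|` coordinatewise, `ℓ²` norms). [cite: Balaban1989LargeFieldI, Prop. 1 p.194] -/
theorem norm_cplxSlice (S : Set (Site P k)) (T : Finset (PBond P k)) (B : GaugeSlice S T E3) : ‖cplxSlice S T B‖ = ‖B‖ := by
  rw [PiLp.norm_eq_of_L2, PiLp.norm_eq_of_L2]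
  congr 1
  refine Finset.sum_congr rfl fun i _ => ?_
  rw [EuclideanSpace.norm_eq, EuclideanSpace.norm_eq]
  congr 2
  refine Finset.sum_congr rfl fun j _ => ?_
  simp

/-- Real and imaginary parts of a complexified coordinate vector (plain functions). [cite: Balaban1989LargeFieldI, Prop. 1 p.194] -/
def reSlice (S : Set (Site P k)) (T : Finset (PBond P k)) (z : GaugeSlice S T (EuclideanSpace ℂ (Fin 3))) : GaugeSlice S T E3 :=
  WithLp.toLp 2 fun i => WithLp.toLp 2 fun j => ((z i) j).re

/-- Imaginary parts, see `reSlice`. [cite: Balaban1989LargeFieldI, Prop. 1 p.194] -/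
def imSlice (S : Set (Site P k)) (T : Finset (PBond P k)) (z : GaugeSlice S T (EuclideanSpace ℂ (Fin 3))) : GaugeSlice S T E3 :=
  WithLp.toLp 2 fun i => WithLp.toLp 2 fun j => ((z i) j).im

/-- **The real coordinates `ℂ`-span the complexified ones**: `z = cplxSlice (re z) + i·cplxSlice (im z)`. [cite: Balaban1989LargeFieldI, Prop. 1 p.194] -/
theorem cplxSlice_span (S : Set (Site P k)) (T : Finset (PBond P k)) (z : GaugeSlice S T (EuclideanSpace ℂ (Fin 3))) :
    ∃ a b : GaugeSlice S T E3, z = cplxSlice S T a + (Complex.I : ℂ) • cplxSlice S T b := by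
  refine ⟨reSlice S T z, imSlice S T z, ?_⟩
  ext i j
  simp only [PiLp.add_apply, PiLp.smul_apply, cplxSlice_apply, reSlice, imSlice, smul_eq_mul]
  rw [mul_comm]
  exact (Complex.re_add_im ((z i) j)).symm

/-- **THE ANALYTIC-EXTENSION CLAUSE OF PROPOSITION 1 [IV], TYPED** (p. 194: *«The orbit-valued function V_Λ(V_k↾_{Z∩Λᶜ}) has an analytic
extension for Gᶜ-valued configurations 𝕍_k = V′_kV_k = exp iB′V_k satisfying the same regularity condition as V_k, with B′ ∈ 𝔤ᶜ and small,
e.g., |B′| < ε»*).  At smallness `ε` and datum `V_k`: there is a map `Φ` on the complexified bond fields (`𝔤ᶜ = ℂ³` per bond), `ℂ`-analytic on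
the ball `‖p̃‖ < ε`, such that for every REAL perturbation `p` with `‖p‖ < ε` and every gauge-fixed coordinate `B` (`‖B‖ ≤ r`) of a critical
configuration `exp(i·ιA B)·ext(exp(ip)·V_k)` of the perturbed datum, `Φ (cplxVec p) = cplxSlice B` (the real coordinate inside the complexified coordinate space `GaugeSlice S T ℂ³`) — the orbit-valued
function `p ↦ V_Λ(exp(ip)V_k)`, read through its `G₀`-coordinate, is the restriction of `Φ` to real perturbations. [cite: Balaban1989LargeFieldI,
Prop. 1 p.194] -/
def anExt (S : Set (Site P k)) (T : Finset (PBond P k)) (f : GaugeField P k SU2 → ℝ)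
    (ext : GaugeField P k SU2 → GaugeField P k SU2) (r : ℝ) : ℝ → GaugeField P k SU2 → Prop :=
  fun ε Vk => ∃ Φ : VecField P k (EuclideanSpace ℂ (Fin 3)) → GaugeSlice S T (EuclideanSpace ℂ (Fin 3)),
    AnalyticOnNhd ℂ Φ (ball 0 ε) ∧
    ∀ p : VecField P k E3, ‖p‖ < ε → ∀ B : GaugeSlice S T E3, ‖B‖ ≤ r →
      IsCriticalPt su2Chart (bondsOf S) f (expMul su2Chart (ιA S T B) (ext (expMul su2Chart p Vk))) →
        Φ (cplxVec p) = cplxSlice S T B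

/-- The clause is ANTITONE in the smallness: an analytic extension on the ball of radius `ε′` restricts to every `ε ≤ ε′`.
[cite: Balaban1989LargeFieldI, Prop. 1 p.194 («for ε > 0 sufficiently small»)] -/
theorem anExt_antitone {S : Set (Site P k)} {T : Finset (PBond P k)} {f : GaugeField P k SU2 → ℝ}
    {ext : GaugeField P k SU2 → GaugeField P k SU2} {r ε ε' : ℝ} (h : ε ≤ ε') {Vk : GaugeField P k SU2}
    (hA : anExt S T f ext r ε' Vk) : anExt S T f ext r ε Vk := by
  obtain ⟨Φ, hΦ, hreal⟩ := hA
  exact ⟨Φ, hΦ.mono (Metric.ball_subset_ball h), fun p hp B hB hc => hreal p (hp.trans_le h) B hB hc⟩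

end Clause

/-! ## §2 The junction with r13's complex model -/

section Model

variable {E F : Type*} [NormedAddCommGroup E] [InnerProductSpace ℝ E] [NormedAddCommGroup F] [InnerProductSpace ℝ F]
  {Ec Fc : Type*} [NormedAddCommGroup Ec] [InnerProductSpace ℂ Ec] [FiniteDimensional ℂ Ec]
  [NormedAddCommGroup Fc] [InnerProductSpace ℂ Fc] [CompleteSpace Fc]
  {Pr Pc : Type*} [NormedAddCommGroup Pr] [NormedAddCommGroup Pc] [NormedSpace ℂ Pc]

omit [FiniteDimensional ℂ Ec] [CompleteSpace Fc] in
/-- Real (1.12) at `B` ⇒ complex (1.12) at `ιE B` with the current `emb J` — the three pairings are the real ones (intertwinings, totally real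
`emb`), conjugate-linearity in the variation and the `ℂ`-span of `ιE(E)`. [cite: Balaban1989LargeFieldII, (1.12) p.359 («valid for 𝔤ᶜ-valued
fields»)] -/
theorem eq112_complex_of_real (ιE : E →ₗ[ℝ] Ec) (hspan : ∀ z : Ec, ∃ a b : E, z = ιE a + (Complex.I : ℂ) • ιE b)
    (emb : F →ₗ[ℝ] Fc) (hembI : ∀ u v : F, ⟪emb u, emb v⟫_ℂ = ((⟪u, v⟫_ℝ : ℝ) : ℂ))
    (H : E →ₗ[ℝ] F) (Δ₁ : F →ₗ[ℝ] F) (dV : F → F) (J : F)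
    (Hc : Ec →L[ℂ] Fc) (Hstc : Fc →L[ℂ] Ec) (hadjc : ∀ (x : Ec) (y : Fc), ⟪Hc x, y⟫_ℂ = ⟪x, Hstc y⟫_ℂ)
    (Δ₁c : Fc →L[ℂ] Fc) (W : Fc → Fc)
    (hHc : ∀ X : E, Hc (ιE X) = emb (H X)) (hΔc : ∀ u : F, Δ₁c (emb u) = emb (Δ₁ u)) (hWc : ∀ u : F, W (emb u) = emb (dV u))
    {B : E} (h112 : ∀ δ : E, ⟪H δ, J⟫_ℝ + ⟪H δ, Δ₁ (H B)⟫_ℝ + ⟪H δ, dV (H B)⟫_ℝ = 0) (δc : Ec) :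
    ⟪δc, Hstc (emb J)⟫_ℂ + ⟪δc, Hstc (Δ₁c (Hc (ιE B)))⟫_ℂ + ⟪δc, Hstc (W (Hc (ιE B)))⟫_ℂ = 0 := by
  -- the sum at a real variation `ιE a` is the (real) sum at `a`, cast to `ℂ`
  have hreal : ∀ a : E,
      ⟪ιE a, Hstc (emb J)⟫_ℂ + ⟪ιE a, Hstc (Δ₁c (Hc (ιE B)))⟫_ℂ + ⟪ιE a, Hstc (W (Hc (ιE B)))⟫_ℂ = 0 := by
    intro a
    rw [← hadjc, ← hadjc, ← hadjc, hHc, hHc, hΔc, hWc, hembI, hembI, hembI]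
    rw [← Complex.ofReal_add, ← Complex.ofReal_add, h112 a, Complex.ofReal_zero]
  obtain ⟨a, b, rfl⟩ := hspan δc
  simp only [inner_add_left, inner_smul_left]
  have ha := hreal a
  have hb := hreal b
  linear_combination ha + (starRingEnd ℂ) Complex.I * hb

/-- ★★ **THE ANALYTIC EXTENSION FROM r13's COMPLEX MODEL** ([LF-II] p. 359 *«valid for 𝔤ᶜ-valued fields, hence the existence of the analytic
extension follows immediately»*).  See the module docstring §2 for the data.  Conclusion: a map `Φ : Pc → Ec`, `ℂ`-analytic on `‖p̃‖ < ε`, whose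
value at each real parameter `ιP p` (`‖p‖ < ε`) is `ιE B` for EVERY `B ∈ E` with `‖B‖ ≤ r` solving the real criticality equation (1.12) with the
current `J p`. [cite: Balaban1989LargeFieldII, p.359 (proof of Proposition 1 [IV]), (1.12)–(1.13); Balaban1989LargeFieldI, Prop. 1 p.194;
Balaban1985Variational, Prop. 4 pp.292–293] -/
theorem exists_analyticExt_of_complexModel
    (ιE : E →ₗ[ℝ] Ec) (hιEn : ∀ x : E, ‖ιE x‖ ≤ ‖x‖) (hspan : ∀ z : Ec, ∃ a b : E, z = ιE a + (Complex.I : ℂ) • ιE b)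
    (emb : F →ₗ[ℝ] Fc) (hembI : ∀ u v : F, ⟪emb u, emb v⟫_ℂ = ((⟪u, v⟫_ℝ : ℝ) : ℂ))
    (ιP : Pr → Pc) (hιP : ∀ p, ‖ιP p‖ ≤ ‖p‖)
    (H : E →ₗ[ℝ] F) (Δ₁ : F →ₗ[ℝ] F) (dV : F → F) (J : Pr → F)
    (Hc : Ec →L[ℂ] Fc) (Hstc : Fc →L[ℂ] Ec) (hadjc : ∀ (x : Ec) (y : Fc), ⟪Hc x, y⟫_ℂ = ⟪x, Hstc y⟫_ℂ)
    (Δ₁c : Fc →L[ℂ] Fc) (W : Fc → Fc)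
    (hHc : ∀ X : E, Hc (ιE X) = emb (H X)) (hΔc : ∀ u : F, Δ₁c (emb u) = emb (Δ₁ u)) (hWc : ∀ u : F, W (emb u) = emb (dV u))
    {c : ℝ} (hc : 0 < c) (hposc : ∀ x : Ec, c * ‖x‖ ^ 2 ≤ RCLike.re ⟪Hc x, Δ₁c (Hc x)⟫_ℂ)
    {C₄ a₃ : ℝ} (hW : Prop4Hyp W C₄ a₃) (hC₄ : 0 ≤ C₄) {h₁ hst ρ a r : ℝ} (hh₁ : 0 ≤ h₁) (hhst : 0 ≤ hst) (hρ0 : 0 < ρ)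
    (ha : 0 < a) (hdom : 2 * (ρ + a) ≤ a₃) (hHcn : ∀ x : Ec, ‖Hc x‖ ≤ h₁ * ‖x‖) (hHstcn : ∀ z : Fc, ‖Hstc z‖ ≤ hst * ‖z‖)
    (hρ : h₁ * (3 * r) ≤ ρ) (hsm1 : c⁻¹ * hst * (4 * C₄ * (ρ + a)) * h₁ ≤ 1 / 2)
    (Jc : Pc → Fc) (hJc : ∀ p : Pr, Jc (ιP p) = emb (J p)) {ε : ℝ} (hJcA : AnalyticOnNhd ℂ Jc (ball 0 ε))
    (hJcr : ∀ q : Pc, ‖q‖ < ε → c⁻¹ * hst * ‖Jc q‖ < r) :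
    ∃ Φ : Pc → Ec, AnalyticOnNhd ℂ Φ (ball 0 ε) ∧
      ∀ p : Pr, ‖p‖ < ε → ∀ B : E, ‖B‖ ≤ r →
        (∀ δ : E, ⟪H δ, J p⟫_ℝ + ⟪H δ, Δ₁ (H B)⟫_ℝ + ⟪H δ, dV (H B)⟫_ℝ = 0) → Φ (ιP p) = ιE B := by
  obtain ⟨Kinv, -, hKop, Bsol, hBsol⟩ :=
    prop1IV_complex (ContinuousLinearMap.id ℂ Ec) (fun _ => rfl) (fun _ _ => rfl) Hc Hstc hadjc Δ₁c hc
      (fun x _ => hposc x) hW hC₄ hh₁ hhst hρ0 ha hdom hHcn hHstcn hρ hsm1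
  have hball : ∀ q : Pc, ‖q‖ < ε → ‖Kinv ((ContinuousLinearMap.id ℂ Ec) (Hstc (Jc q)))‖ < r := fun q hq =>
    (hKop (Jc q)).trans_lt (hJcr q hq)
  refine ⟨fun q => Bsol (Jc q), fun q hq => ?_, fun p hp B hB h112 => ?_⟩
  · have hq' : ‖q‖ < ε := by simpa using hq
    exact ((hBsol (Jc q) (hball q hq')).1).comp (hJcA q hq)
  · have hp' : ‖ιP p‖ < ε := (hιP p).trans_lt hp
    obtain ⟨-, -, -, -, huniq⟩ := hBsol (Jc (ιP p)) (hball (ιP p) hp')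
    symm
    refine huniq (ιE B) rfl ?_ fun δc _ => ?_
    · have hr : 0 ≤ r := (norm_nonneg B).trans hB
      exact (hιEn B).trans (hB.trans (by linarith))
    · rw [hJc]
      exact eq112_complex_of_real ιE hspan emb hembI H Δ₁ dV (J p) Hc Hstc hadjc Δ₁c W hHc hΔc hWc h112 δc

end Model

/-! ## §3 The clause at the carrier of record -/

section Carrier

variable {P : Params} {k : ℕ} [DecidableEq (PBond P k)]
  {F : Type*} [NormedAddCommGroup F] [InnerProductSpace ℝ F]
  {Fc : Type*} [NormedAddCommGroup Fc] [InnerProductSpace ℂ Fc] [CompleteSpace Fc]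

/-- ★★ **THE ANALYTIC-EXTENSION CLAUSE AT THE CARRIER OF RECORD FROM THE COMPLEX MODEL.**  For a site set `S`, tree `T`, function `f`,
extension map `ext`, radius `r`, datum `V_k`: given the (c3)∕(m5)-shape letter `hc3p` at the perturbed data — for every real perturbation
`‖p‖ < ε` and gauge-fixed coordinate `‖B‖ ≤ r`, the configuration `exp(i·ιA B)·ext(exp(ip)V_k)` is critical iff the real (1.12) holds with the
data `(H, Δ₁, dV, J p)` (r13's reading: `H_{1,k}`, `Δ₁(ζ₀)`, `(δ/δA)V` the reference-background operators, the datum entering through the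
current `J p = J_{k,Z}(ext(exp(ip)V_k))`) —, and the complex model of §2 over the parameter space of complexified bond fields (`ιP = cplxVec`):
`anExt S T f ext r Ec ιE ε V_k`. [cite: Balaban1989LargeFieldI, Prop. 1 p.194; Balaban1989LargeFieldII, p.359 («valid for 𝔤ᶜ-valued fields,
hence the existence of the analytic extension follows immediately»); Balaban1985Variational, Prop. 4 pp.292–293] -/
theorem anExt_of_complexModel {S : Set (Site P k)} {T : Finset (PBond P k)} (f : GaugeField P k SU2 → ℝ)
    (ext : GaugeField P k SU2 → GaugeField P k SU2) {r ε : ℝ} (Vk : GaugeField P k SU2)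
    (H : GaugeSlice S T E3 →ₗ[ℝ] F) (Δ₁ : F →ₗ[ℝ] F) (dV : F → F) (J : VecField P k E3 → F)
    (hc3p : ∀ p : VecField P k E3, ‖p‖ < ε → ∀ B : GaugeSlice S T E3, ‖B‖ ≤ r →
      (IsCriticalPt su2Chart (bondsOf S) f (expMul su2Chart (ιA S T B) (ext (expMul su2Chart p Vk))) ↔
        ∀ δ : GaugeSlice S T E3, ⟪H δ, J p⟫_ℝ + ⟪H δ, Δ₁ (H B)⟫_ℝ + ⟪H δ, dV (H B)⟫_ℝ = 0))
    (emb : F →ₗ[ℝ] Fc) (hembI : ∀ u v : F, ⟪emb u, emb v⟫_ℂ = ((⟪u, v⟫_ℝ : ℝ) : ℂ))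
    (Hc : GaugeSlice S T (EuclideanSpace ℂ (Fin 3)) →L[ℂ] Fc) (Hstc : Fc →L[ℂ] GaugeSlice S T (EuclideanSpace ℂ (Fin 3)))
    (hadjc : ∀ (x : GaugeSlice S T (EuclideanSpace ℂ (Fin 3))) (y : Fc), ⟪Hc x, y⟫_ℂ = ⟪x, Hstc y⟫_ℂ)
    (Δ₁c : Fc →L[ℂ] Fc) (W : Fc → Fc)
    (hHc : ∀ X, Hc (cplxSlice S T X) = emb (H X)) (hΔc : ∀ u : F, Δ₁c (emb u) = emb (Δ₁ u))
    (hWc : ∀ u : F, W (emb u) = emb (dV u))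
    {c : ℝ} (hc : 0 < c) (hposc : ∀ x : GaugeSlice S T (EuclideanSpace ℂ (Fin 3)), c * ‖x‖ ^ 2 ≤ RCLike.re ⟪Hc x, Δ₁c (Hc x)⟫_ℂ)
    {C₄ a₃ : ℝ} (hW : Prop4Hyp W C₄ a₃) (hC₄ : 0 ≤ C₄) {h₁ hst ρ a : ℝ} (hh₁ : 0 ≤ h₁) (hhst : 0 ≤ hst) (hρ0 : 0 < ρ)
    (ha : 0 < a) (hdom : 2 * (ρ + a) ≤ a₃) (hHcn : ∀ x, ‖Hc x‖ ≤ h₁ * ‖x‖) (hHstcn : ∀ z : Fc, ‖Hstc z‖ ≤ hst * ‖z‖)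
    (hρ : h₁ * (3 * r) ≤ ρ) (hsm1 : c⁻¹ * hst * (4 * C₄ * (ρ + a)) * h₁ ≤ 1 / 2)
    (Jc : VecField P k (EuclideanSpace ℂ (Fin 3)) → Fc) (hJc : ∀ p : VecField P k E3, Jc (cplxVec p) = emb (J p))
    (hJcA : AnalyticOnNhd ℂ Jc (ball 0 ε)) (hJcr : ∀ q, ‖q‖ < ε → c⁻¹ * hst * ‖Jc q‖ < r) :
    anExt S T f ext r ε Vk := by
  obtain ⟨Φ, hΦA, hΦ⟩ := exists_analyticExt_of_complexModel (cplxSlice S T) (fun x => (norm_cplxSlice S T x).le)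
    (cplxSlice_span S T) emb hembI cplxVec (fun p => (norm_cplxVec p).le) H Δ₁ dV J Hc Hstc hadjc Δ₁c W hHc hΔc hWc hc hposc
    hW hC₄ hh₁ hhst hρ0 ha hdom hHcn hHstcn hρ hsm1 Jc hJc hJcA hJcr
  exact ⟨Φ, hΦA, fun p hp B hB hcrit => hΦ p hp B hB ((hc3p p hp B hB).1 hcrit)⟩

end Carrier

end Literature.MathematicalPhysics.QuantumFieldTheory.Balaban1983to89.B15Prop1AnalyticExtClause

end
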